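import Summits.CriticalPhenomena.PercolationContinuityZ3.Theorems.PercNearOneGluingNoHeavyPcintWinKernelFast
import Literature.Probability.Percolation.SiteConnectionTools
import HarnessLib

/-!
# PCINT lane, kernel window certificates modulo the hyperoctahedral group — invariance and normal forms

Cell `prim-pcint`, seat `prim-pcint-2` (gen 2); memo `run/shared/lean/prim/pcint/REDUCTIONS.md` §R2 (symmetry quotient),
INTERVAL-PLAN §14.  Does NOT build on p205010.  The Collatz–Wielandt rows of the kernel window certificates
(`…PcintWinKernelCert`) are checked on ALL `(2d)^n` window codes; but the window tests are invariant under the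
hyperoctahedral group `B_d` (signed coordinate permutations), so it suffices to check the rows on windows in
first-use normal form.  This file provides the ingredients:
* the action `WinK.actStep` / `WinK.actW` of `SPerm d = Perm(Fin d) × (Fin d → Bool)` on steps and windows and its
  realisation `WinK.toS` by the tree's `Site.signedPerm` (`toS_stepVec`, `wordPos_actW`);
* invariance of the GENUINE window quantities (`isSAW_actW_iff`, `winChordTrue_actW`, `winGapTrue_actW`,
  `winCornerTrue_actW_iff`, `chordEdges_actW_eq_empty_iff`);
* exactness of the computable tests of `…PcintWinKernel` (`okc_eq_true_iff`, `gN_eq_winGapTrue`, `cN_eq_true_iff`,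
  `okN_eq_true_iff`; `cc_eq` is already there), hence their invariance (`okc_actW`, `cc_actW`, `gN_actW`, `cN_actW`,
  `okN_actW`);
* the first-use normal form test `isNF` and **`exists_isNF_actW`**: every window has a normal form in its orbit.
-/

namespace Summit.CriticalPhenomena.PercolationContinuityZ3.Theorems.Pcint

open Finset Literature.Probability.Percolation Literature.Probability.LatticeModels

namespace WinK

variable {d m : ℕ}

/-! ### The action of signed permutations on steps and windows -/

/-- A signed coordinate permutation: the axis permutation and, per ORIGINAL axis, whether its sign is flipped. [folklore] -/
abbrev SPerm (d : ℕ) : Type := Equiv.Perm (Fin d) × (Fin d → Bool)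

/-- Action on a step. [folklore] -/
def actStep (g : SPerm d) (a : Fin d × Bool) : Fin d × Bool := (g.1 a.1, xor a.2 (g.2 a.1))

/-- Action on a step word (pointwise). [folklore] -/
def actW {n : ℕ} (g : SPerm d) (w : Fin n → Fin d × Bool) : Fin n → Fin d × Bool := fun i => actStep g (w i)

/-- The signs of `g` as units, indexed by the image axis. [folklore] -/
def sgn (g : SPerm d) : Fin d → ℤˣ := fun i => if g.2 (g.1.symm i) then -1 else 1

/-- The lattice isometry of `g` (the tree's `Site.signedPerm`). [folklore] -/
def toS (g : SPerm d) : Site d ≃ Site d := Site.signedPerm g.1 (sgn g)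

/-- `toS` is additive. [folklore] -/
theorem toS_add (g : SPerm d) (x y : Site d) : toS g (x + y) = toS g x + toS g y := Site.signedPerm_add _ _ x y

/-- `toS` commutes with negation. [folklore] -/
theorem toS_neg (g : SPerm d) (x : Site d) : toS g (-x) = -toS g x := by
  funext j; simp [toS]

/-- `toS` fixes the origin. [folklore] -/
@[simp] theorem toS_zero (g : SPerm d) : toS g 0 = 0 := Site.signedPerm_zero _ _

/-- `toS` on unit vectors. [folklore] -/
theorem toS_single (g : SPerm d) (i : Fin d) :
    toS g (Pi.single i 1) = if g.2 i then -Pi.single (g.1 i) 1 else Pi.single (g.1 i) 1 := by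
  rw [toS, Site.signedPerm_single]
  simp only [sgn, Equiv.symm_apply_apply]
  split_ifs <;> simp

/-- **Steps transform like their unit vectors**: `toS g (stepVec a) = stepVec (g • a)`. [folklore] -/
theorem toS_stepVec (g : SPerm d) (a : Fin d × Bool) : toS g (stepVec a) = stepVec (actStep g a) := by
  obtain ⟨i, b⟩ := a
  cases b <;> cases h : g.2 i <;> simp [stepVec, actStep, h, toS_neg, toS_single]

/-- **Positions transform by the isometry**: `wordPos (g • w) k = toS g (wordPos w k)`. [folklore] -/
theorem wordPos_actW (g : SPerm d) {n : ℕ} (w : Fin n → Fin d × Bool) :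
    ∀ k, wordPos (actW g w) k = toS g (wordPos w k)
  | 0 => by simp
  | k + 1 => by
    by_cases hk : k < n
    · rw [wordPos_succ _ hk, wordPos_succ _ hk, wordPos_actW g w k, toS_add, toS_stepVec]; rfl
    · have h1 : ∀ v : Fin n → Fin d × Bool, wordPos v (k + 1) = wordPos v k := fun v => by
        simp [wordPos, Finset.sum_range_succ, hk]
      rw [h1, h1, wordPos_actW g w k]

/-- Extending commutes with the action. [folklore] -/
theorem wext_actW (g : SPerm d) (u : Fin (m + 1) → Fin d × Bool) (a : Fin d × Bool) :
    wext (actW g u) (actStep g a) = actW g (wext u a) := by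
  funext i; simp only [wext, actW]; split_ifs <;> rfl

/-- Shifting commutes with the action. [folklore] -/
theorem wshift_actW (g : SPerm d) (u : Fin (m + 1) → Fin d × Bool) (a : Fin d × Bool) :
    wshift (actW g u) (actStep g a) = actW g (wshift u a) := by
  funext i; simp only [wshift, wext_actW]; rfl

/-- The isometry preserves adjacency. [folklore] -/
theorem adj_toS_iff (g : SPerm d) {x y : Site d} : (zdGraph d).Adj (toS g x) (toS g y) ↔ (zdGraph d).Adj x y :=
  (zdSignedPermIso g.1 (sgn g)).map_adj_iff

/-! ### Invariance of the genuine window quantities -/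

/-- Self-avoidance is invariant. [folklore] -/
theorem isSAW_actW_iff (g : SPerm d) {n : ℕ} (w : Fin n → Fin d × Bool) : IsSAW (actW g w) ↔ IsSAW w := by
  simp only [IsSAW, wordPos_actW, (toS g).injective.eq_iff]

/-- The visible chord count is invariant. [folklore] -/
theorem winChordTrue_actW (g : SPerm d) (u : Fin (m + 1) → Fin d × Bool) (a : Fin d × Bool) :
    winChordTrue (actW g u) (actStep g a) = winChordTrue u a := by
  unfold winChordTrue
  rw [wext_actW]
  congr 1
  refine filter_congr fun j _ => ?_
  rw [wordPos_actW, wordPos_actW, adj_toS_iff]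

/-- Absence of chords as a universally quantified statement. [folklore] -/
theorem chordEdges_eq_empty_iff {n : ℕ} (v : Fin n → Fin d × Bool) :
    chordEdges v = ∅ ↔ ∀ i j : ℕ, i + 2 ≤ j → j ≤ n → ¬ (zdGraph d).Adj (wordPos v i) (wordPos v j) := by
  constructor
  · intro h i j hij hjn hadj
    have : s(wordPos v i, wordPos v j) ∈ chordEdges v := mem_chordEdges.2 ⟨i, j, hij, hjn, hadj, rfl⟩
    rw [h] at this
    exact Finset.notMem_empty _ this
  · intro h
    refine Finset.eq_empty_iff_forall_notMem.2 fun e he => ?_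
    obtain ⟨i, j, hij, hjn, hadj, -⟩ := mem_chordEdges.1 he
    exact h i j hij hjn hadj

/-- Absence of chords is invariant. [folklore] -/
theorem chordEdges_actW_eq_empty_iff (g : SPerm d) {n : ℕ} (w : Fin n → Fin d × Bool) :
    chordEdges (actW g w) = ∅ ↔ chordEdges w = ∅ := by
  rw [chordEdges_eq_empty_iff, chordEdges_eq_empty_iff]
  simp only [wordPos_actW, adj_toS_iff]

/-- The gap set transforms by the isometry. [folklore] -/
theorem winGapSet_actW (g : SPerm d) (u : Fin (m + 1) → Fin d × Bool) (a : Fin d × Bool) :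
    winGapSet (actW g u) (actStep g a) = (winGapSet u a).map (toS g).toEmbedding := by
  ext x
  rw [Finset.mem_map_equiv, mem_winGapSet, mem_winGapSet, wext_actW]
  simp only [wordPos_actW]
  have hx : x = toS g ((toS g).symm x) := ((toS g).apply_symm_apply x).symm
  constructor
  · rintro ⟨h1, h2, i, hi, h3⟩
    refine ⟨?_, fun j hj hje => h2 j hj ?_, i, hi, ?_⟩
    · rw [hx, adj_toS_iff] at h1; exact h1
    · rw [hje, ← hx]
    · rw [hx, adj_toS_iff] at h3; exact h3
  · rintro ⟨h1, h2, i, hi, h3⟩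
    refine ⟨?_, fun j hj hje => h2 j hj ?_, i, hi, ?_⟩
    · rw [hx, adj_toS_iff]; exact h1
    · rw [← (toS g).symm_apply_apply (wordPos (wext u a) j), hje]
    · rw [hx, adj_toS_iff]; exact h3

/-- The gap count is invariant. [folklore] -/
theorem winGapTrue_actW (g : SPerm d) (u : Fin (m + 1) → Fin d × Bool) (a : Fin d × Bool) :
    winGapTrue (actW g u) (actStep g a) = winGapTrue u a := by
  rw [winGapTrue, winGapTrue, winGapSet_actW, Finset.card_map]

/-- The corner condition is invariant. [folklore] -/
theorem winCornerTrue_actW_iff (g : SPerm d) (u : Fin (m + 1) → Fin d × Bool) (a : Fin d × Bool) :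
    WinCornerTrue (actW g u) (actStep g a) ↔ WinCornerTrue u a := by
  unfold WinCornerTrue
  rw [wext_actW]
  have hc : wordPos (actW g (wext u a)) m + stepVec (actStep g a) = toS g (wordPos (wext u a) m + stepVec a) := by
    rw [wordPos_actW, ← toS_stepVec, toS_add]
  rw [hc]
  simp only [wordPos_actW, ne_eq, (toS g).injective.eq_iff, adj_toS_iff]

/-! ### Exactness of the computable tests, hence their invariance -/

/-- `getD` inside the list is `getElem`. [folklore] -/
private theorem getD_eq_getElem'' {l : List ℤ} {i : ℕ} (h : i < l.length) : l.getD i 0 = l[i] := by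
  rw [List.getD_eq_getElem?_getD, List.getElem?_eq_getElem h, Option.getD_some]

/-- Reading back a site of `ℤ^d` as a list inverts `toSite` on lists of length `d`. [folklore] -/
theorem ofFn_toSite {x : List ℤ} (hx : x.length = d) : List.ofFn (toSite x : Site d) = x := by
  refine List.ext_getElem (by simp [hx]) fun i h1 h2 => ?_
  rw [List.getElem_ofFn]
  simp only [toSite]
  rw [getD_eq_getElem'' h2]

/-- **The acceptance test is exact**: `okc u a` iff the extended window is self-avoiding. [folklore] -/
theorem okc_eq_true_iff (u : Fin (m + 1) → Fin d × Bool) (a : Fin d × Bool) : okc u a = true ↔ IsSAW (wext u a) := by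
  refine ⟨fun h => ?_, hok u a⟩
  rw [okc, decide_eq_true_eq, sites] at h
  have hinj := (List.nodup_map_iff_inj_on List.nodup_range).1 h
  intro i j hi hj hij
  exact hinj i (List.mem_range.2 (by omega)) j (List.mem_range.2 (by omega))
    (toSite_inj (length_posL u a i) (length_posL u a j)
      (by rw [← wordPos_eq_posL u a (by omega), ← wordPos_eq_posL u a (by omega), hij]))

/-- **The gap count is exact.** [folklore] -/
theorem gN_eq_winGapTrue (u : Fin (m + 1) → Fin d × Bool) (a : Fin d × Bool) : gN u a = winGapTrue u a := by
  refine le_antisymm (hgN u a) ?_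
  unfold gN winGapTrue
  refine Finset.card_le_card_of_injOn (fun y : Site d => List.ofFn y) (fun y hy => ?_)
    (fun x _ y _ h => List.ofFn_injective h)
  change List.ofFn y ∈ (gapSitesL u a : Set (List ℤ))
  rw [mem_coe, mem_winGapSet] at hy
  obtain ⟨hadj, hoff, i, hi, hadji⟩ := hy
  obtain ⟨e, he⟩ := (zdGraph_adj_iff_stepVec _ _).1 hadj
  have hlen : (addL (posL u a (m + 2)) (toL d e)).length = d := length_addL (length_posL u a _) (length_toL _)
  have hy : y = toSite (addL (posL u a (m + 2)) (toL d e)) := by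
    rw [he, wordPos_eq_posL u a le_rfl, toSite_addL (length_posL u a _) (length_toL _), toSite_toL]
  have hofFn : List.ofFn y = addL (posL u a (m + 2)) (toL d e) := by rw [hy, ofFn_toSite hlen]
  rw [mem_coe, gapSitesL, mem_filter, mem_image]
  refine ⟨⟨e, mem_univ _, hofFn.symm⟩, fun hmem => ?_, ?_⟩
  · obtain ⟨j, hj, hje⟩ := mem_sites.1 hmem
    exact hoff j hj (by rw [wordPos_eq_posL u a hj, hje, hofFn, ← hy])
  · rw [List.any_eq_true]
    refine ⟨i, List.mem_range.2 (by omega), ?_⟩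
    rw [hofFn, ← adj_iff_adjL (length_posL u a i) hlen, ← hy, ← wordPos_eq_posL u a (by omega)]
    exact hadji

/-- **The corner flag is exact.** [folklore] -/
theorem cN_eq_true_iff (u : Fin (m + 1) → Fin d × Bool) (a : Fin d × Bool) : cN u a = true ↔ WinCornerTrue u a := by
  refine ⟨hcN u a, fun h => ?_⟩
  obtain ⟨hoff, hall⟩ := h
  have hlen : (cornerL u a).length = d := length_addL (length_posL u a _) (length_toL _)
  have hcorner : wordPos (wext u a) m + stepVec a = toSite (cornerL u a) := by
    rw [wordPos_eq_posL u a (by omega), cornerL, toSite_addL (length_posL u a _) (length_toL _), toSite_toL]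
  rw [cN, Bool.and_eq_true, decide_eq_true_eq, List.all_eq_true]
  refine ⟨fun hmem => ?_, fun i hi => ?_⟩
  · obtain ⟨j, hj, hje⟩ := mem_sites.1 hmem
    exact hoff j hj (by rw [hcorner, wordPos_eq_posL u a hj, hje])
  · rw [List.mem_range] at hi
    have hna := hall i hi
    rw [hcorner, wordPos_eq_posL u a (by omega), adj_iff_adjL (length_posL u a i) hlen] at hna
    simpa using hna

/-- **The NAW acceptance test is exact.** [folklore] -/
theorem okN_eq_true_iff (u : Fin (m + 1) → Fin d × Bool) (a : Fin d × Bool) :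
    okN u a = true ↔ IsSAW (wext u a) ∧ chordEdges (wext u a) = ∅ := by
  refine ⟨fun h => ?_, fun h => hokN u a h.1 h.2⟩
  rw [okN, Bool.and_eq_true] at h
  obtain ⟨h1, h2⟩ := h
  refine ⟨(okc_eq_true_iff u a).1 h1, (chordEdges_eq_empty_iff _).2 fun i j hij hjn hadj => ?_⟩
  rw [List.all_eq_true] at h2
  have hj' := h2 j (List.mem_range.2 (by omega))
  rw [List.all_eq_true] at hj'
  have hi' := hj' i (List.mem_range.2 (by omega))
  rw [adj_posL_iff u a (by omega) (by omega)] at hadj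
  rw [hadj] at hi'
  exact Bool.noConfusion hi'

/-- `okc` is invariant. [folklore] -/
theorem okc_actW (g : SPerm d) (u : Fin (m + 1) → Fin d × Bool) (a : Fin d × Bool) :
    okc (actW g u) (actStep g a) = okc u a := by
  rw [Bool.eq_iff_iff, okc_eq_true_iff, okc_eq_true_iff, wext_actW, isSAW_actW_iff]

/-- `cc` is invariant. [folklore] -/
theorem cc_actW (g : SPerm d) (u : Fin (m + 1) → Fin d × Bool) (a : Fin d × Bool) :
    cc (actW g u) (actStep g a) = cc u a := by
  rw [cc_eq, cc_eq, winChordTrue_actW]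

/-- `gN` is invariant. [folklore] -/
theorem gN_actW (g : SPerm d) (u : Fin (m + 1) → Fin d × Bool) (a : Fin d × Bool) :
    gN (actW g u) (actStep g a) = gN u a := by
  rw [gN_eq_winGapTrue, gN_eq_winGapTrue, winGapTrue_actW]

/-- `cN` is invariant. [folklore] -/
theorem cN_actW (g : SPerm d) (u : Fin (m + 1) → Fin d × Bool) (a : Fin d × Bool) :
    cN (actW g u) (actStep g a) = cN u a := by
  rw [Bool.eq_iff_iff, cN_eq_true_iff, cN_eq_true_iff, winCornerTrue_actW_iff]

/-- `okN` is invariant. [folklore] -/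
theorem okN_actW (g : SPerm d) (u : Fin (m + 1) → Fin d × Bool) (a : Fin d × Bool) :
    okN (actW g u) (actStep g a) = okN u a := by
  rw [Bool.eq_iff_iff, okN_eq_true_iff, okN_eq_true_iff, wext_actW, isSAW_actW_iff, chordEdges_actW_eq_empty_iff]

/-! ### First-use normal form -/

/-- One step of the normal-form scan: `some k` = so far in normal form with `k` distinct axes `0, …, k-1`. [folklore] -/
def nfStep : Option ℕ → Fin d × Bool → Option ℕ
  | none, _ => none
  | some k, a => if (a.1 : ℕ) < k then some k else if (a.1 : ℕ) = k ∧ a.2 = true then some (k + 1) else none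

/-- The scan of a step list. [folklore] -/
def nfScan (l : List (Fin d × Bool)) : Option ℕ := l.foldl nfStep (some 0)

/-- **First-use normal form**: the axes occur in the order `0, 1, 2, …` of first use, and the first use of each
axis is a positive step. [folklore] -/
def isNF {n : ℕ} (w : Fin n → Fin d × Bool) : Bool := (nfScan (List.ofFn w)).isSome

/-- A failed scan stays failed. [folklore] -/
theorem foldl_nfStep_none (l : List (Fin d × Bool)) : l.foldl nfStep none = none := by
  induction l with
  | nil => rfl
  | cons a l ih => exact ih

/-- A successful scan bounds every axis by the final count, which only grows. [folklore] -/
theorem foldl_nfStep_some {l : List (Fin d × Bool)} : ∀ {k₀ k : ℕ}, l.foldl nfStep (some k₀) = some k →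
    (∀ a ∈ l, (a.1 : ℕ) < k) ∧ k₀ ≤ k := by
  induction l with
  | nil => intro k₀ k h; simp only [List.foldl_nil, Option.some.injEq] at h; subst h; simp
  | cons a l ih =>
    intro k₀ k h
    rw [List.foldl_cons] at h
    by_cases h1 : (a.1 : ℕ) < k₀
    · rw [show nfStep (some k₀) a = some k₀ by simp [nfStep, h1]] at h
      obtain ⟨hl, hk⟩ := ih h
      exact ⟨fun b hb => by
        rcases List.mem_cons.1 hb with rfl | hb
        · omega
        · exact hl b hb, hk⟩
    · by_cases h2 : (a.1 : ℕ) = k₀ ∧ a.2 = true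
      · rw [show nfStep (some k₀) a = some (k₀ + 1) by simp [nfStep, h2]] at h
        obtain ⟨hl, hk⟩ := ih h
        exact ⟨fun b hb => by
          rcases List.mem_cons.1 hb with rfl | hb
          · omega
          · exact hl b hb, by omega⟩
      · rw [show nfStep (some k₀) a = none by simp [nfStep, h1, h2], foldl_nfStep_none] at h
        exact absurd h (by simp)

/-- Scanning one more step. [folklore] -/
theorem nfScan_append_singleton (l : List (Fin d × Bool)) (a : Fin d × Bool) :
    nfScan (l ++ [a]) = nfStep (nfScan l) a := by
  simp [nfScan, List.foldl_append]

/-- The step list of a transformed word. [folklore] -/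
theorem ofFn_actW (g : SPerm d) {n : ℕ} (w : Fin n → Fin d × Bool) :
    List.ofFn (actW g w) = (List.ofFn w).map (actStep g) := by
  rw [List.map_ofFn]; rfl

/-- **Every window has a first-use normal form in its `B_d`-orbit.** (Relabel the axes in the order of first use and
flip the signs so that first uses are positive; by induction on the length, extending the relabelling by a
transposition when a new axis appears.) [folklore] -/
theorem exists_isNF_actW : ∀ {n : ℕ} (w : Fin n → Fin d × Bool), ∃ g : SPerm d, isNF (actW g w) = true
  | 0, w => ⟨(1, fun _ => false), by simp [isNF, nfScan]⟩
  | n + 1, w => by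
    obtain ⟨g', hg'⟩ := exists_isNF_actW (Fin.init w)
    rw [isNF, Option.isSome_iff_exists] at hg'
    obtain ⟨k, hk⟩ := hg'
    have hbound := (foldl_nfStep_some (l := List.ofFn (actW g' (Fin.init w))) hk).1
    set a := w (Fin.last n) with ha
    have hsplit : ∀ g : SPerm d, List.ofFn (actW g w) = List.ofFn (actW g (Fin.init w)) ++ [actStep g a] := by
      intro g
      rw [ofFn_actW, ofFn_actW, List.ofFn_succ', List.concat_eq_append, List.map_append, List.map_singleton]
      rfl
    by_cases hlt : ((g'.1 a.1 : Fin d) : ℕ) < k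
    · refine ⟨g', ?_⟩
      rw [isNF, hsplit, nfScan_append_singleton, show nfScan (List.ofFn (actW g' (Fin.init w))) = some k from hk]
      simp [nfStep, actStep, hlt]
    · -- a new axis: send it to `k` by a transposition and make its first use positive
      have hkd : k < d := lt_of_le_of_lt (not_lt.1 hlt) (g'.1 a.1).isLt
      let kF : Fin d := ⟨k, hkd⟩
      let π : Equiv.Perm (Fin d) := g'.1.trans (Equiv.swap (g'.1 a.1) kF)
      let ε : Fin d → Bool := Function.update g'.2 a.1 (!a.2)
      have hfix : ∀ i : Fin n, actStep (π, ε) (Fin.init w i) = actStep g' (Fin.init w i) := by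
        intro i
        have hi : ((g'.1 (Fin.init w i).1 : Fin d) : ℕ) < k := by
          have := hbound (actStep g' (Fin.init w i))
            (by rw [ofFn_actW]; exact List.mem_map.2 ⟨Fin.init w i, List.mem_ofFn.2 ⟨i, rfl⟩, rfl⟩)
          simpa [actStep] using this
        have hne : (Fin.init w i).1 ≠ a.1 := by
          intro h; rw [h] at hi; exact hlt hi
        have h1 : g'.1 (Fin.init w i).1 ≠ g'.1 a.1 := fun h => hne (g'.1.injective h)
        have h2 : g'.1 (Fin.init w i).1 ≠ kF := fun h => by
          have := congrArg Fin.val h; simp [kF] at this; omega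
        simp only [actStep, π, ε, Equiv.trans_apply, Equiv.swap_apply_of_ne_of_ne h1 h2, Function.update_of_ne hne]
      have hsame : actW (π, ε) (Fin.init w) = actW g' (Fin.init w) := funext hfix
      refine ⟨(π, ε), ?_⟩
      rw [isNF, hsplit, hsame, nfScan_append_singleton,
        show nfScan (List.ofFn (actW g' (Fin.init w))) = some k from hk]
      have hlast : actStep (π, ε) a = (kF, true) := by
        simp only [actStep, π, ε, Equiv.trans_apply, Equiv.swap_apply_left, Function.update_self, Bool.xor_not_self]
      rw [hlast]
      simp [nfStep, kF]

end WinK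

end Summit.CriticalPhenomena.PercolationContinuityZ3.Theorems.Pcint
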